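import Literature.NumberTheory.IwasawaTheory.ClassGroupPRankLeOfRelation
import Literature.NumberTheory.IwasawaTheory.CyclotomicTwoLayerTwoNonNormUnit
import Literature.NumberTheory.IwasawaTheory.CyclotomicTwoTotallyRamifiedOddIndex
import Literature.NumberTheory.IwasawaTheory.ClassNumberPExpLayerOneEqOneOfGenusCertificate
import Literature.NumberTheory.NumberFields.QuadraticSqrtTwoClassNumberNotDvdFour
import Literature.NumberTheory.NumberFields.QuadraticSqrtTwoNormTwoPrimeCertificate
import HarnessLib

/-!
# THE RELATION DOOR at `p = 2`, layer `K_2`, in base-field currency: `2 ∤ h_K`, two dyadic primes, `ε ≢ ±1 (mod 𝔭₁⁴)` (so `4 ∤ #Cl(K_2)^G`), a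
# class `c ∈ Cl(K_2)` whose norm to `K_1` is represented by `𝔄` with `N_{K_1/K}(𝔄)^k = (π)`, `π ≡ ±3 (mod 𝔭₁³)` (so `c ∉ Cl^{σ−1}·Cl²`), and ONE
# relation `∏ σ^i(c)^{f_i} = 1` of order `d ≤ 2` at `σ = 1` modulo `2` ⟹ `rank₂ Cl(K_m) ≤ d ∀ m`, `μ₂ = 0`, `λ₂ ≤ d`

Topic `NumberTheory/IwasawaTheory` (namespace = path).  THEOREMS ONLY (no definition, no named fact, no instance, no `sorry`); unconditional.
Written by the prover seat `bsd-line-att-p3` g48 (cell `bsd-f1-sign2`, WIDTH-5 attach on route `AlignedTransportAtTwo`, crux C2 stmt-BirchSwinnertonDyer-22298;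
`--supports`, closes nothing).  Sequel of this seat's `ClassGroupPRankLeOfRelation` (the door for every `p`) — here its two abstract hypotheses are put into
the cell's currencies at `p = 2`, `n = 2`:

* **`4 ∤ #Cl(K_2)^{Gal(K_2/K)}`** ⟸ Chevalley: `2 ∤ h_K`, two ramified primes and ONE unit of `K` outside `N_{K_2/K} K_2ˣ` ⟸ `ε ∓ 1 ∉ 𝔭₁⁴` (att-p3 g46,
  `not_four_dvd_card_fixed_layer_two_of_not_mem` + `unitsIncl_unitsMap_not_mem_map_norm_layer_two`);
* **`c ∉ Cl(K_2)^{σ−1}·Cl(K_2)²`** ⟸ `N_{K_2/K_1}(c)` is NOT a square in `Cl(K_1)` (`exists_sq_eq_classGroupNorm_layer_one`: `N(σb·b⁻¹·e²) = (σ₁y·y)·y⁻²·(Ne)²`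
  with `σ₁y·y = i(N_{K_1/K} y)` a class of odd order, hence a square) ⟸ the GENUS CERTIFICATE of `not_exists_sq_eq_mk0_of_genusCert`: `K_1 = K(√2)`, all units
  `≡ ±1 (mod 𝔭₁³)`, and an integral representative `𝔄` of `N_{K_2/K_1}(c)` with `N_{K_1/K}(𝔄)^k = (π)`, `π ≡ ±3 (mod 𝔭₁³)` (if `[𝔄] = y²` then
  `𝔅²𝔄 = (δ)` for an integral `𝔅 ∈ y⁻¹`, `N(𝔅)^{h} = (b)`, and `N(δ^{kh}) = w·(b^k)²·π^h` with `h = h_K` odd — excluded by att-p3 g43's key lemma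
  `intNorm_ne_unit_mul_sq_mul_pow`, i.e. by the dyadic symbol `(·, 2)_{𝔭₁}`).

* `not_exists_sq_eq_mk0_of_genusCert` — `L = K(√2)`: the NON-SQUARE certificate for a class of `Cl(L)` from one norm generator `≡ ±3 (mod 𝔭₁³)`.
* `exists_sq_eq_classGroupNorm_layer_one` — `2 ∤ h_K`: `N_{K_2/K_1}(σ(b)·b⁻¹·e²)` is a square in `Cl(K_1)`, for EVERY `σ ∈ Gal(K_2/K)`.
* ★★ `not_exists_eq_conj_div_mul_sq_of_genusCert` — the generator certificate: `c ∉ Cl(K_2)^{σ−1}·Cl(K_2)²`.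
* `prod_pow_mulEquiv_intAut_mk0_eq_one` — plumbing for the rows: `∏ σ^i(𝔍)^{f_i} = (ξ)` as ideals ⟹ the class relation `∏ (σ^i•[𝔍])^{f_i} = 1` (`hrel`).
* ★★★ `classicalMuVanishes_two_of_relation_of_genusCert` — THE DOOR: odd degree, `2 ∤ d_K`, `κ` cyclotomic, two dyadic primes, `2 ∤ h_K`, `𝓞_K/𝔭₁ = 𝔽₂`,
  `ε ∓ 1 ∉ 𝔭₁⁴`, units `≡ ±1 (mod 𝔭₁³)`, the genus certificate `(𝔄, k, π)` for `c`, and one relation of order `d ≤ 2` ⟹ `rank₂ Cl(K_m) ≤ d ∀ m`, `μ₂ = 0`, `λ₂ ≤ d`.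

CELL READING (crux C2; `F = ℚ(β)` complex cubic, `Δ_W ≡ 5 (8)`, `2 = 𝔭₁𝔭₂`, `h_F = 1`, `t = 3`: the HARD CORE `e₁ = 1` and the pro-cyclic class `e₁ ≥ 2` alike): the
per-seed certificate of `μ₂ = 0` becomes (i) a prime `𝔠` of `F_2 = F(θ)` over a prime `𝔠₁` of `F_1 = F(√2)` over `𝔮 = (π)` of `F` with `π ≡ ±3 (mod 𝔭₁³)` and
(ii) ONE PRINCIPAL GENERATOR of `∏ σ^i(𝔠)^{f_i}` with `f ≢ 0, 1+X+X²+X³ (mod 2)` — lower-bound type, PARI `bnfisprincipal`; no class number, unit group or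
non-principality of the degree-12 field.  Nothing about any seed is asserted here; BSD is not advanced by this file.

## References

* L. C. Washington, *Introduction to Cyclotomic Fields*, 2nd ed. (1997), §13.3 Lemmas 13.15, 13.18, Prop. 13.22–13.23. [Washington1997]
* G. Gras, *Class Field Theory* (2003), IV.4 (genus theory: ambiguous classes, genus characters). [Gras2003]
* J.-P. Serre, *A Course in Arithmetic* (1973), Ch. III §1.2 Thm. 1 (the dyadic Hilbert symbol). [Serre1973CourseArithmetic]
* J. Neukirch, *Algebraic Number Theory* (1999), Ch. III §1 (1.6) (relative norm of ideals), Ch. I §9 (9.6). [NeukirchANT1999]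
* S. Lang, *Cyclotomic Fields I and II*, GTM 121 (1990), Ch. 13 §4 Lemma 4.1. [Lang1990]
* T. Fukuda, *Remarks on `ℤ_p`-extensions of number fields*, Proc. Japan Acad. 70 A (1994), Thm. 1. [Fukuda1994]
-/

set_option autoImplicit false

noncomputable section

open scoped NumberField nonZeroDivisors
open NumberField IsDedekindDomain Field Polynomial Finset

namespace Literature.NumberTheory.IwasawaTheory

open Literature.NumberTheory.EllipticCurves Literature.NumberTheory.NumberFields Literature.NumberTheory.NumberFields.AmbiguousClass
  Literature.NumberTheory.GaloisRepresentations Literature.NumberTheory.GaloisRepresentations.Herbrand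

/-! ## §1 The non-square certificate in `Cl(K(√2))` -/

section NonSquare

variable {K L : Type} [Field K] [NumberField K] [Field L] [NumberField L] [Algebra K L]

/-- **THE NON-SQUARE CERTIFICATE.**  `L/K` Galois quadratic with `s² = 2`, `s ∉ K`; `h_K` odd; `𝔭₁` a non-zero prime of `𝓞_K` with residue field `𝔽₂` and
`2 ∈ 𝔭₁ ∖ 𝔭₁²`; every unit of `K` is `≡ ±1 (mod 𝔭₁³)`; `π ≡ ±3 (mod 𝔭₁³)`; `𝔄 ≠ 0` an ideal of `𝓞_L` with **`N_{L/K}(𝔄)^k = (π)`**.  THEN **the class of `𝔄` is not a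
square in `Cl(L)`**: `[𝔄] = y²` gives an integral `𝔅 ∈ y⁻¹` with `𝔅²𝔄 = (δ)`, `N(𝔅)²N(𝔄) = (Nδ)`, `N(𝔅)^h = (b)` (`h = h_K`), so `N(δ^{kh}) = w·(b^k)²·π^h` with `h` odd —
against the key lemma `intNorm_ne_unit_mul_sq_mul_pow` (the genus character `(·, 2)_{𝔭₁}`). [cite: Gras2003, IV.4 (genus characters)]
[cite: Serre1973CourseArithmetic, Ch. III §1.2, Thm. 1] [cite: NeukirchANT1999, Ch. III §1 (1.6)] -/
theorem not_exists_sq_eq_mk0_of_genusCert [IsGalois K L] (h2 : Module.finrank K L = 2) {s : L} (hs : s ^ 2 = 2)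
    (hsK : ∀ k : K, algebraMap K L k ≠ s) (hodd : Odd (classNumber K))
    (P : Ideal (𝓞 K)) [P.IsMaximal] (hP0 : P ≠ ⊥) (hres : ∀ r : 𝓞 K, r ∈ P ∨ r - 1 ∈ P)
    (h2P : (2 : 𝓞 K) ∈ P) (h2P' : (2 : 𝓞 K) ∉ P ^ 2)
    (hunits : ∀ u : (𝓞 K)ˣ, (u : 𝓞 K) - 1 ∈ P ^ 3 ∨ (u : 𝓞 K) + 1 ∈ P ^ 3)
    {π : 𝓞 K} (hπ : π - 3 ∈ P ^ 3 ∨ π + 3 ∈ P ^ 3)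
    {A : Ideal (𝓞 L)} (hA0 : A ≠ ⊥) {k : ℕ} (hA : Ideal.relNorm (𝓞 K) A ^ k = Ideal.span {π}) :
    ¬ ∃ y : ClassGroup (𝓞 L), y ^ 2 = ClassGroup.mk0 ⟨A, mem_nonZeroDivisors_of_ne_zero hA0⟩ := by
  classical
  rintro ⟨y, hy⟩
  set Anz : (Ideal (𝓞 L))⁰ := ⟨A, mem_nonZeroDivisors_of_ne_zero hA0⟩ with hAnz
  -- an integral representative `𝔅` of `y⁻¹`; `𝔅² 𝔄` is principal
  obtain ⟨B, hB⟩ := ClassGroup.mk0_surjective y⁻¹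
  have hprin : ClassGroup.mk0 (B ^ 2 * Anz) = 1 := by
    rw [map_mul, map_pow, hB, inv_pow, ← hy, inv_mul_cancel]
  have hval : (B ^ 2 * Anz : (Ideal (𝓞 L))⁰) = ⟨(B : Ideal (𝓞 L)) ^ 2 * A,
      mem_nonZeroDivisors_of_ne_zero (mul_ne_zero (pow_ne_zero _ (nonZeroDivisors.ne_zero B.2)) hA0)⟩ := by
    apply Subtype.ext
    simp [hAnz]
  rw [hval, ClassGroup.mk0_eq_one_iff] at hprin
  haveI := hprin
  obtain ⟨δ, hδ⟩ := Submodule.IsPrincipal.principal ((B : Ideal (𝓞 L)) ^ 2 * A)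
  rw [Ideal.submodule_span_eq] at hδ
  -- relative norms: `N(𝔅)² · N(𝔄) = (N δ)`
  have hN := congrArg (Ideal.relNorm (𝓞 K)) hδ
  rw [map_mul, map_pow, Ideal.relNorm_singleton] at hN
  -- `N(𝔅)^h = (b)` with `h = h_K`
  have hB0 : Ideal.relNorm (𝓞 K) (B : Ideal (𝓞 L)) ≠ ⊥ := by
    rw [Ne, Ideal.relNorm_eq_bot_iff]
    exact nonZeroDivisors.ne_zero B.2
  set NB : (Ideal (𝓞 K))⁰ := ⟨Ideal.relNorm (𝓞 K) (B : Ideal (𝓞 L)),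
    mem_nonZeroDivisors_of_ne_zero (by rwa [Ne, Ideal.zero_eq_bot])⟩ with hNB
  have hh : ClassGroup.mk0 (NB ^ classNumber K) = 1 := by
    rw [map_pow, classNumber]
    exact pow_card_eq_one
  have hvalB : (NB ^ classNumber K : (Ideal (𝓞 K))⁰) = ⟨Ideal.relNorm (𝓞 K) (B : Ideal (𝓞 L)) ^ classNumber K,
      mem_nonZeroDivisors_of_ne_zero (pow_ne_zero _ (by rwa [Ne, Ideal.zero_eq_bot]))⟩ := by
    apply Subtype.ext
    simp [hNB]
  rw [hvalB, ClassGroup.mk0_eq_one_iff] at hh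
  haveI := hh
  obtain ⟨b, hb⟩ := Submodule.IsPrincipal.principal (Ideal.relNorm (𝓞 K) (B : Ideal (𝓞 L)) ^ classNumber K)
  rw [Ideal.submodule_span_eq] at hb
  have hb0 : b ≠ 0 := by
    intro h0
    rw [h0, Ideal.span_singleton_eq_bot.mpr rfl] at hb
    exact pow_ne_zero _ (by rwa [Ne, ← Ideal.zero_eq_bot] at hB0) (hb.trans Ideal.zero_eq_bot.symm)
  -- raise `N(𝔅)² N(𝔄) = (Nδ)` to the power `k`: `N(𝔅)^{2k} (π) = (N(δ^k))`
  have h1 : Ideal.relNorm (𝓞 K) (B : Ideal (𝓞 L)) ^ (2 * k) * Ideal.span {π} =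
      Ideal.span {Algebra.intNorm (𝓞 K) (𝓞 L) (δ ^ k)} := by
    rw [← hA, pow_mul, ← mul_pow, hN, Ideal.span_singleton_pow, ← map_pow]
  -- raise to the power `h`: `((b^k)² π^h) = (N(δ^{kh}))`
  have h2' : Ideal.span {(b ^ k) ^ 2 * π ^ classNumber K} =
      Ideal.span {Algebra.intNorm (𝓞 K) (𝓞 L) ((δ ^ k) ^ classNumber K)} := by
    have h : (Ideal.relNorm (𝓞 K) (B : Ideal (𝓞 L)) ^ (2 * k) * Ideal.span {π}) ^ classNumber K =
        Ideal.span {Algebra.intNorm (𝓞 K) (𝓞 L) (δ ^ k)} ^ classNumber K := by rw [h1]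
    rw [mul_pow, ← pow_mul, mul_comm (2 * k) (classNumber K), pow_mul, hb, Ideal.span_singleton_pow,
      Ideal.span_singleton_pow, Ideal.span_singleton_pow, Ideal.span_singleton_mul_span_singleton, ← map_pow] at h
    rw [← h, mul_comm 2 k, pow_mul]
  rw [Ideal.span_singleton_eq_span_singleton] at h2'
  obtain ⟨u, hu⟩ := h2'
  exact intNorm_ne_unit_mul_sq_mul_pow h2 hs hsK P hP0 hres h2P h2P' hπ ((δ ^ k) ^ classNumber K) (pow_ne_zero k hb0)
    (hunits u) hodd (by rw [← hu]; ring)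

end NonSquare

/-! ## §2 The generator certificate and the door at `p = 2`, layer `K_2` -/

section LayerTwo

variable {K : Type} [Field K] [NumberField K]

/-- **`N_{K_2/K_1}(σ(b)·b⁻¹·e²)` is a square in `Cl(K_1)`** (`2 ∤ h_K`, ANY `σ ∈ Gal(K_2/K)`): the norm is `Γ_K`-equivariant (tree
`classGroupNorm_layer_layer_mulEquiv_intAut_absRestrictNormalHom`), so `N(σb) = σ₁ N b` with `σ₁ = σ|_{K_1}`; if `σ₁ = 1` nothing is left, else
`Gal(K_1/K) = {1, σ₁}` and `y·σ₁y = i(N_{K_1/K} y)` (Neukirch (1.6)(iv), tree `classGroupExtend_classGroupNorm_eq_prod`) is the extension of a class of ODD order — a square.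
[cite: NeukirchANT1999, Ch. III §1 Prop. (1.6) (iv)] [cite: Washington1997, §13.3 (norm maps are `Γ`-maps)] -/
theorem exists_sq_eq_classGroupNorm_layer_one (κ : ZpExtension K 2) (hK : ¬ 2 ∣ classNumber K)
    [NumberField (κ.layer 1)] [NumberField (κ.layer 2)] [Algebra (κ.layer 1) (κ.layer 2)] [IsScalarTower K (κ.layer 1) (κ.layer 2)]
    (σ : (κ.layer 2) ≃ₐ[K] (κ.layer 2)) {c b e : ClassGroup (𝓞 (κ.layer 2))}
    (h : c = ClassGroup.mulEquiv (intAut σ) b / b * e ^ 2) :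
    ∃ y : ClassGroup (𝓞 (κ.layer 1)), y ^ 2 = classGroupNorm (κ.layer 1) (κ.layer 2) c := by
  classical
  haveI : Fact (Nat.Prime 2) := ⟨Nat.prime_two⟩
  haveI : FiniteDimensional K (κ.layer 1) := κ.finiteDimensional_layer_holds 1
  haveI : FiniteDimensional K (κ.layer 2) := κ.finiteDimensional_layer_holds 2
  haveI : IsGalois K (κ.layer 1) := κ.isGalois_layer_holds 1
  haveI : IsGalois K (κ.layer 2) := κ.isGalois_layer_holds 2
  haveI : Normal K (κ.layer 1) := IsGalois.to_normal
  haveI : Normal K (κ.layer 2) := IsGalois.to_normal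
  obtain ⟨γ, hγ⟩ := absRestrictNormalHom_surjective (κ.layer 2) σ
  set N := classGroupNorm (κ.layer 1) (κ.layer 2) with hN
  set σ₁ : (κ.layer 1) ≃ₐ[K] (κ.layer 1) := absRestrictNormalHom (κ.layer 1) γ with hσ₁
  set y₀ := N b with hy₀
  have hNσ : N (ClassGroup.mulEquiv (intAut σ) b) = ClassGroup.mulEquiv (intAut σ₁) y₀ := by
    rw [← hγ, hN, classGroupNorm_layer_layer_mulEquiv_intAut_absRestrictNormalHom κ γ b]
  -- `σ₁ y₀ / y₀` is a square
  have hsq : ∃ w : ClassGroup (𝓞 (κ.layer 1)), w ^ 2 = ClassGroup.mulEquiv (intAut σ₁) y₀ / y₀ := by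
    by_cases h1 : σ₁ = 1
    · refine ⟨1, ?_⟩
      rw [h1, mulEquiv_intAut_one, MulEquiv.refl_apply, div_self', one_pow]
    · have hne1 : (1 : (κ.layer 1) ≃ₐ[K] (κ.layer 1)) ≠ σ₁ := fun h' => h1 h'.symm
      have huniv : ({1, σ₁} : Finset ((κ.layer 1) ≃ₐ[K] (κ.layer 1))) = Finset.univ := by
        refine Finset.eq_univ_of_card _ ?_
        rw [Finset.card_pair hne1, ← Nat.card_eq_fintype_card, IsGalois.card_aut_eq_finrank, κ.finrank_layer_holds 1, pow_one]
      have hprod : y₀ * ClassGroup.mulEquiv (intAut σ₁) y₀ =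
          classGroupExtend K (κ.layer 1) (classGroupNorm K (κ.layer 1) y₀) := by
        rw [classGroupExtend_classGroupNorm_eq_prod K (κ.layer 1) y₀, ← huniv, Finset.prod_pair hne1, mulEquiv_intAut_one,
          MulEquiv.refl_apply]
      -- the class `z = N_{K_1/K} y₀` has odd order: `z = (z^{m+1})²` with `h_K = 2m + 1`
      set z := classGroupNorm K (κ.layer 1) y₀ with hz
      obtain ⟨m, hm⟩ : Odd (classNumber K) := Nat.odd_iff.mpr (Nat.two_dvd_ne_zero.mp hK)
      have hzsq : z = (z ^ (m + 1)) ^ 2 := by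
        rw [← pow_mul, show (m + 1) * 2 = classNumber K + 1 by omega, pow_succ, classNumber, pow_card_eq_one, one_mul]
      refine ⟨classGroupExtend K (κ.layer 1) (z ^ (m + 1)) / y₀, ?_⟩
      rw [div_pow, ← map_pow, ← hzsq, ← hprod, pow_two, mul_div_mul_comm, div_self', one_mul]
  obtain ⟨w, hw⟩ := hsq
  refine ⟨w * N e, ?_⟩
  rw [h, map_mul, _root_.map_div, hNσ, map_pow, mul_pow, hw]

/-- ★★ **THE GENERATOR CERTIFICATE.**  `K` of odd degree with `2 ∤ d_K`, `κ` a cyclotomic `ℤ₂`-extension (so `K_1 = K(√2)`), `2 ∤ h_K`; `𝔭₁ ∋ 2` maximal with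
`𝓞_K/𝔭₁ = 𝔽₂` and `2 ∉ 𝔭₁²`; every unit of `K` `≡ ±1 (mod 𝔭₁³)`; `π ≡ ±3 (mod 𝔭₁³)`; an ideal `𝔄 ≠ 0` of `𝓞_{K_1}` with **`N_{K_1/K}(𝔄)^k = (π)`** representing the norm
`N_{K_2/K_1}(c)` of a class `c ∈ Cl(K_2)`.  THEN **`c` is not of the form `σ(b)·b⁻¹·e²`** for any `σ ∈ Gal(K_2/K)` — `c` lies outside `𝔪·Cl(K_2)`, `𝔪 = (2, σ−1)`.
[cite: Gras2003, IV.4] [cite: NeukirchANT1999, Ch. III §1 (1.6)] [cite: Serre1973CourseArithmetic, Ch. III §1.2, Thm. 1] -/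
theorem not_exists_eq_conj_div_mul_sq_of_genusCert (hK2 : ¬ 2 ∣ Module.finrank ℚ K) (hd : ¬ (2 : ℤ) ∣ NumberField.discr K)
    (κ : ZpExtension K 2) (hκ : κ.IsCyclotomic) (hh : ¬ 2 ∣ classNumber K)
    [NumberField (κ.layer 1)] [NumberField (κ.layer 2)] [Algebra (κ.layer 1) (κ.layer 2)] [IsScalarTower K (κ.layer 1) (κ.layer 2)]
    (P : Ideal (𝓞 K)) [P.IsMaximal] (hres : ∀ r : 𝓞 K, r ∈ P ∨ r - 1 ∈ P) (h2P : (2 : 𝓞 K) ∈ P)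
    (hunits : ∀ u : (𝓞 K)ˣ, (u : 𝓞 K) - 1 ∈ P ^ 3 ∨ (u : 𝓞 K) + 1 ∈ P ^ 3)
    {π : 𝓞 K} (hπ : π - 3 ∈ P ^ 3 ∨ π + 3 ∈ P ^ 3)
    {A : Ideal (𝓞 (κ.layer 1))} (hA0 : A ≠ ⊥) {k : ℕ} (hA : Ideal.relNorm (𝓞 K) A ^ k = Ideal.span {π})
    (σ : (κ.layer 2) ≃ₐ[K] (κ.layer 2)) {c : ClassGroup (𝓞 (κ.layer 2))}
    (hcA : classGroupNorm (κ.layer 1) (κ.layer 2) c = ClassGroup.mk0 ⟨A, mem_nonZeroDivisors_of_ne_zero hA0⟩) :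
    ¬ ∃ b e : ClassGroup (𝓞 (κ.layer 2)), c = ClassGroup.mulEquiv (intAut σ) b / b * e ^ 2 := by
  rintro ⟨b, e, h⟩
  obtain ⟨y, hy⟩ := exists_sq_eq_classGroupNorm_layer_one κ hh σ h
  rw [hcA] at hy
  haveI : IsGalois K (κ.layer 1) := κ.isGalois_layer_holds 1
  obtain ⟨s, hs⟩ := exists_sq_eq_two_layer_one_of_not_dvd_finrank hK2 κ hκ
  have hsK := forall_algebraMap_ne_of_sq_eq_two hd hs
  have h2 : Module.finrank K (κ.layer 1) = 2 := by rw [κ.finrank_layer_holds 1, pow_one]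
  have hP0 : P ≠ ⊥ := fun h0 => by
    rw [h0, Ideal.mem_bot] at h2P
    exact two_ne_zero h2P
  have h2P' : (2 : 𝓞 K) ∉ P ^ 2 := two_not_mem_sq_of_not_dvd_discr hd P h2P
  exact not_exists_sq_eq_mk0_of_genusCert h2 hs hsK (Nat.odd_iff.mpr (Nat.two_dvd_ne_zero.mp hh)) P hP0 hres h2P h2P' hunits hπ
    hA0 hA ⟨y, hy⟩

/-- ★★★ **THE RELATION DOOR AT `p = 2`, LAYER `K_2`, FROM BASE-FIELD DATA.**  `K` a number field of odd degree with `2 ∤ d_K` and exactly two primes above `2`,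
`κ` a cyclotomic `ℤ₂`-extension, `2 ∤ h_K`; `𝔭₁ ∋ 2` maximal with `𝓞_K/𝔭₁ = 𝔽₂`; a unit `ε` with **`ε − 1 ∉ 𝔭₁⁴`, `ε + 1 ∉ 𝔭₁⁴`** (depth `t = 3`: `4 ∤ #Cl(K_2)^G`);
every unit `≡ ±1 (mod 𝔭₁³)`; a class `c ∈ Cl(K_2)` with the GENUS CERTIFICATE `(𝔄, k, π)`: `𝔄 ≠ 0` an ideal of `𝓞_{K_1}` with `N_{K_2/K_1}(c) = [𝔄]`,
`N_{K_1/K}(𝔄)^k = (π)`, `π ≡ ±3 (mod 𝔭₁³)`; `σ` a generator of `Gal(K_2/K)`; and **ONE RELATION `∏_{i<N} σ^i(c)^{f_i} = 1`** with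
`∑ f_i X^i = (X−1)^d·u + 2·g`, `u(1)` odd, **`d ≤ 2`**.  THEN **`rank₂ Cl(K_m) ≤ d` for every `m`, `μ₂(κ) = 0`, `λ₂(κ) ≤ d`.**
[cite: Washington1997, §13.3 Prop. 13.22–13.23] [cite: Lang1990, Ch. 13 §4 Lemma 4.1] [cite: Gras2003, IV.4] [cite: Fukuda1994, Thm. 1, p. 264] -/
theorem classicalMuVanishes_two_of_relation_of_genusCert (hK2 : ¬ 2 ∣ Module.finrank ℚ K) (hd : ¬ (2 : ℤ) ∣ NumberField.discr K)
    (κ : ZpExtension K 2) (hκ : κ.IsCyclotomic)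
    (h2card : {w : HeightOneSpectrum (𝓞 K) | ((2 : ℕ) : 𝓞 K) ∈ w.asIdeal}.ncard = 2)
    (hh : ¬ 2 ∣ classNumber K)
    [NumberField (κ.layer 1)] [NumberField (κ.layer 2)] [Algebra (κ.layer 1) (κ.layer 2)] [IsScalarTower K (κ.layer 1) (κ.layer 2)]
    (P : Ideal (𝓞 K)) [P.IsMaximal] (hres : ∀ r : 𝓞 K, r ∈ P ∨ r - 1 ∈ P) (h2P : (2 : 𝓞 K) ∈ P)
    (ε : (𝓞 K)ˣ) (hε1 : (ε : 𝓞 K) - 1 ∉ P ^ 4) (hε2 : (ε : 𝓞 K) + 1 ∉ P ^ 4)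
    (hunits : ∀ u : (𝓞 K)ˣ, (u : 𝓞 K) - 1 ∈ P ^ 3 ∨ (u : 𝓞 K) + 1 ∈ P ^ 3)
    {π : 𝓞 K} (hπ : π - 3 ∈ P ^ 3 ∨ π + 3 ∈ P ^ 3)
    {A : Ideal (𝓞 (κ.layer 1))} (hA0 : A ≠ ⊥) {k : ℕ} (hA : Ideal.relNorm (𝓞 K) A ^ k = Ideal.span {π})
    (σ : (κ.layer 2) ≃ₐ[K] (κ.layer 2)) (hσ : ∀ τ : (κ.layer 2) ≃ₐ[K] (κ.layer 2), τ ∈ Subgroup.zpowers σ)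
    {c : ClassGroup (𝓞 (κ.layer 2))}
    (hcA : classGroupNorm (κ.layer 1) (κ.layer 2) c = ClassGroup.mk0 ⟨A, mem_nonZeroDivisors_of_ne_zero hA0⟩)
    {N d : ℕ} (hd2 : d ≤ 2) {f : ℕ → ℤ} {u g : ℤ[X]} (hu : ¬ (2 : ℤ) ∣ u.eval 1)
    (hF : (∑ i ∈ range N, C (f i) * X ^ i : ℤ[X]) = (X - 1) ^ d * u + C (2 : ℤ) * g)
    (hrel : ∏ i ∈ range N, (ClassGroup.mulEquiv (intAut (σ ^ i)) c) ^ (f i) = 1) :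
    (∀ m, classGroupPRank κ m ≤ d) ∧ ClassicalMuVanishes κ ∧ classicalLambda κ ≤ d := by
  haveI : Fact (Nat.Prime 2) := ⟨Nat.prime_two⟩
  have hP0 : P ≠ ⊥ := fun h0 => by
    rw [h0, Ideal.mem_bot] at h2P
    exact two_ne_zero h2P
  have h2P' : (2 : 𝓞 K) ∉ P ^ 2 := two_not_mem_sq_of_not_dvd_discr hd P h2P
  have hodd := forall_odd_ramificationIdx_of_not_dvd_discr hd
  have hκ0 : TotallyRamifiedFrom κ 0 := totallyRamifiedFrom_zero_of_forall_odd_ramificationIdx hK2 κ hκ hodd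
  -- `4 ∤ #Cl(K_2)^G` from the non-norm unit `ε`
  have hfix : ¬ 2 ^ 2 ∣ Nat.card {c : ClassGroup (𝓞 (κ.layer 2)) //
      ∀ τ : (κ.layer 2) ≃ₐ[K] (κ.layer 2), ClassGroup.mulEquiv (intAut τ) c = c} := by
    rw [show (2 : ℕ) ^ 2 = 4 by norm_num]
    exact not_four_dvd_card_fixed_layer_two_of_not_mem κ hκ0 hh
      (by rw [ncard_ramified_layer_eq_ncard_dyadic hK2 κ hκ hodd one_le_two, h2card]) (unitsIncl_unitsMap_mem_unitsE_inf_range ε)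
      (unitsIncl_unitsMap_not_mem_map_norm_layer_two hK2 κ hκ P hP0 hres h2P h2P' ε hε1 hε2)
  -- the generator certificate
  have hc := not_exists_eq_conj_div_mul_sq_of_genusCert hK2 hd κ hκ hh P hres h2P hunits hπ hA0 hA σ hcA
  have hp2 : ¬ ((2 : ℕ) : ℤ) ∣ u.eval 1 := by exact_mod_cast hu
  have hF' : (∑ i ∈ range N, C (f i) * X ^ i : ℤ[X]) = (X - 1) ^ d * u + C (((2 : ℕ) : ℤ)) * g := by exact_mod_cast hF
  exact classicalMuVanishes_and_classicalLambda_le_of_relation κ hκ0 σ hσ hfix hc (by norm_num; omega) hp2 hF' hrel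

end LayerTwo

/-! ## §3 Plumbing for the rows: the relation from ONE principal generator -/

section Rows

variable {F L : Type} [Field F] [Field L] [NumberField L] [Algebra F L]

/-- **The relation from one principal generator.**  If the ideal `∏_{i<N} σ^i(𝔍)^{f_i}` of `𝓞_L` (conjugates `σ^i(𝔍) = 𝔍.map (intAut σ^i)`) is the principal
ideal `(ξ)`, then the classes satisfy **`∏_{i<N} (σ^i • [𝔍])^{f_i} = 1`** in `Cl(L)` — the hypothesis `hrel` of the relation door with non-negative exponents
(`σ • [𝔍] = [σ(𝔍)]`, tree `AmbiguousClass.mulEquiv_mk0`; `[𝔄] = 1` iff `𝔄` is principal). [cite: NeukirchANT1999, Ch. I §9 (9.6) and §3 (the class group)] -/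
theorem prod_pow_mulEquiv_intAut_mk0_eq_one (σ : L ≃ₐ[F] L) {J : Ideal (𝓞 L)} (hJ : J ≠ ⊥) {N : ℕ} {f : ℕ → ℕ} {ξ : 𝓞 L}
    (h : ∏ i ∈ range N, (J.map (intAut (σ ^ i) : 𝓞 L →+* 𝓞 L)) ^ f i = Ideal.span {ξ}) :
    ∏ i ∈ range N, (ClassGroup.mulEquiv (intAut (σ ^ i)) (ClassGroup.mk0 ⟨J, mem_nonZeroDivisors_of_ne_zero hJ⟩)) ^ (f i : ℤ) = 1 := by
  classical
  set Jnz : (Ideal (𝓞 L))⁰ := ⟨J, mem_nonZeroDivisors_of_ne_zero hJ⟩ with hJnz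
  have hconj : ∀ i, ClassGroup.mulEquiv (intAut (σ ^ i)) (ClassGroup.mk0 Jnz) =
      ClassGroup.mk0 ⟨_, map_mem_nonZeroDivisors (σ ^ i) Jnz⟩ := fun i => mulEquiv_mk0 (σ ^ i) Jnz
  simp_rw [zpow_natCast, hconj, ← map_pow, ← map_prod]
  rw [ClassGroup.mk0_eq_one_iff]
  have hval : ((∏ i ∈ range N, (⟨_, map_mem_nonZeroDivisors (σ ^ i) Jnz⟩ : (Ideal (𝓞 L))⁰) ^ f i : (Ideal (𝓞 L))⁰) : Ideal (𝓞 L)) =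
      ∏ i ∈ range N, (J.map (intAut (σ ^ i) : 𝓞 L →+* 𝓞 L)) ^ f i := by
    rw [SubmonoidClass.coe_finsetProd]
    exact Finset.prod_congr rfl fun i _ => by rw [SubmonoidClass.coe_pow]
  rw [hval, h]
  exact ⟨⟨ξ, by rw [Ideal.submodule_span_eq]⟩⟩

end Rows

end Literature.NumberTheory.IwasawaTheory

end
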